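import Literature.Barriers.ValiantsHypothesis.KroneckerXRayMachineAdmissible
import Literature.Computability.Complexity.TwoDXRayCircuitBoard
import HarnessLib

/-!
# The simplex embedding `2D-X-RAY → KRONECKER` on codes, III: the output, `xrayToKronecker ∈ FP`,
# and KRONECKER is NP-hard (Ikenmeyer–Mulmuley–Walter 2017, Thm. 1.1) — discharged

Third machine file. On a code `w = encode (μ', ν', ρ')` the Kronecker code of the
embedded instance is `encodePartition λ ++ encodePartition μ ++ encodePartition π` with
`encodePartition λ = unaryList [c_0, …, c_{X_0 - 1}]`, `c_j = #{i ≤ r : j < X_i}`,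
`X_i = tri (r - i) + μ'_i` (`encodePartition_xrayLam`, `KroneckerXRayCodes.lean`), and likewise
for `Y`, `Z`. This file tabulates these codes by two nested indexed folds (`countF`: the marks
`[j < X_i]` over `i ≤ r`; `blockF`: the blocks `1^{c_j} 0` over `j < X_0`), assembles

  `xrayToKroneckerF = (canonXF ∧ admissibleF) ? codeK 1 ++ codeK 2 ++ codeK 3 : noCode`

(`canonXF`: file I; `admissibleF`: file II), proves `xrayToKroneckerF ∈ FP` and, by the value
theorems on every string, **`xrayToKroneckerF = xrayToKronecker`** (the map of
`KroneckerPositivityHardnessProofs.lean`, defined there by cases). Consequences: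

* **`FischerIkenmeyer2020_xrayToKronecker_mem_FP_holds`** — discharge of the residual named fact
  of the Kronecker half of the barrier entry;
* **`IMW2017_kroneckerNPHard_holds : IsNPHard KroneckerPositivity`** — Ikenmeyer–Mulmuley–Walter
  2017, Thm. 1.1 "deciding positivity of Kronecker coefficients is NP-hard", now fully proved in
  the tree (Cook–Levin → `SAT ≤ₚ 3SAT` → `3SAT ≤ₚ ONEIN3SAT` → ladder complex
  `ONEIN3SAT ≤ₚ TWODXRAY` (`GGP1999_twoDXRayNPHard_holds`) → simplex embedding
  `TWODXRAY ≤ₚ KRONECKER` (IMW Thms. 3.2–3.4 / FI Thm. 5, `mem_TWODXRAY_iff_xrayToKronecker_mem`));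
* `kroneckerPlethysmHardness_of_plethysm : FischerIkenmeyer2020_plethysmNPHard →
  KroneckerPlethysmHardness` — the barrier conjunction now rests on the plethysm half alone.

## References

* [IkenmeyerMulmuleyWalter2017] C. Ikenmeyer, K. D. Mulmuley, M. Walter, *On vanishing of
  Kronecker coefficients*, Comput. Complexity 26 (2017) 949–992, Thm. 1.1, Thms. 3.2–3.4.
* [FischerIkenmeyer2020] N. Fischer, C. Ikenmeyer, Comput. Complexity 29 (2020) 8, Thm. 5, §6.
* [BrunettiDelLungoGerard2001] S. Brunetti, A. Del Lungo, Y. Gérard, Linear Algebra Appl. 339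
  (2001) 59–73, Thm. 3.1 ("a polynomial-time transformation").
* [AroraBarak2009] S. Arora, B. Barak, *Computational Complexity*, CUP 2009, §1.3.
-/

noncomputable section

namespace Literature.Barriers.ValiantsHypothesis

namespace XRayKron

open _root_.Computability Polynomial Finset Literature.Computability.Complexity Literature.Computability.Complexity.Brick
  Literature.Computability.Complexity.Ladder3 Literature.Computability.Complexity.HashBricks
  Literature.Computability.Complexity.Plumb Literature.Computability.Complexity.OneInThree
  Literature.NumberTheory.DiophantineGeometry Literature.Combinatorics.Enumerative.Tomography

/-! ### The lifted marginals in unary -/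

/-- The lifted marginal of list `k`: `tri (r - i) + l_i`, `r + 1 = |μ'|`. [folklore] -/
def liftK (k : ℕ) (a b c : List ℕ) (i : ℕ) : ℕ := tri (a.length - 1 - i) + (lst k a b c).getD i 0

/-- `liftK 1 = liftX`, `liftK 2 = liftY`, `liftK 3 = liftZ` (with `r = |μ'| - 1`). [folklore] -/
theorem liftK_one (a b c : List ℕ) : liftK 1 a b c = liftX (a.length - 1) a := by
  funext i; rw [liftK, lst_one, liftX_eq]
/-- Value of `liftK`. [folklore] -/
theorem liftK_two (a b c : List ℕ) : liftK 2 a b c = liftY (a.length - 1) b := by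
  funext i; rw [liftK, lst_two, liftY_eq]
/-- Value of `liftK`. [folklore] -/
theorem liftK_three (a b c : List ℕ) : liftK 3 a b c = liftZ (a.length - 1) c := by
  funext i; rw [liftK, lst_three, liftZ_eq]

/-- `1^{tri n}` from `1ⁿ` computed by `g`: `halfFn (umulFn ⟨g, 1 g⟩)`. [folklore] -/
def triOf (g : List Bool → List Bool) : List Bool → List Bool := halfFn ∘ umulFn ∘ fanoutFn g (List.cons true ∘ g)

/-- `triOf`: membership in `FP` by composition. [cite: AroraBarak2009, §1.3] -/
theorem triOf_mem_FP {g : List Bool → List Bool} (hg : g ∈ FP) : triOf g ∈ FP :=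
  comp_mem_FP halfFn_mem_FP (comp_mem_FP umulFn_mem_FP (fanoutFn_mem_FP hg (comp_mem_FP (cons_mem_FP true) hg)))

/-- Value of `triOf`. [folklore] -/
theorem triOf_val {g : List Bool → List Bool} {q : List Bool} {n : ℕ} (h : g q = ones n) : triOf g q = ones (tri n) := by
  simp only [triOf, Function.comp_apply, fanoutFn_apply, h, show true :: ones n = ones (n + 1) by simp [List.replicate_succ],
    umulFn_boolPair, halfFn, List.length_replicate, tri]

/-! ### The inner fold: the count `c_j = #{i ≤ r : j < X_i}` -/

/-- On the inner argument `⟨⟨w, 1ʲ⟩, 1ⁱ⟩`: `1^{r - i}`. [folklore] -/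
def rmi2 : List Bool → List Bool := dropFn ∘ fanoutFn sndF (rF ∘ fstF ∘ fstF)
/-- On the inner argument: item `i` of list `k`. [folklore] -/
def item2 (k : ℕ) : List Bool → List Bool := nthItemFn ∘ fanoutFn sndF (sndF ∘ zF k ∘ fstF ∘ fstF)
/-- On the inner argument: `1^{X_i}` for list `k`. [folklore] -/
def xi2 (k : ℕ) : List Bool → List Bool := appendFn ∘ fanoutFn (triOf rmi2) (item2 k)
/-- On the inner argument: the mark `[j < X_i]` (`[1]` or `ε`). [folklore] -/
def bitP (k : ℕ) : List Bool → List Bool :=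
  iteFn (ltLenF ∘ fanoutFn (sndF ∘ fstF) (xi2 k)) (fun _ => [true]) (fun _ => [])
/-- The initial record of the inner fold: `⟨q, ⟨bin (r+1), ⟨1⁰, ε⟩⟩⟩`. [folklore] -/
def initI : List Bool → List Bool :=
  fanoutFn id (fanoutFn (lenBinF ∘ fstF ∘ z1F ∘ fstF) (fun _ => boolPair (ones 0) []))
/-- **The count** `1^{c_j}` on `⟨w, 1ʲ⟩`. [folklore] -/
def countF (k : ℕ) : List Bool → List Bool := sndPow 2 ∘ foldLoop appF (clipF 1 (bitP k)) X ∘ initI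

/-- `rmi2`: membership in `FP` by composition. [cite: AroraBarak2009, §1.3] -/
theorem rmi2_mem_FP : rmi2 ∈ FP :=
  comp_mem_FP dropFn_mem_FP (fanoutFn_mem_FP sndF_mem_FP (comp_mem_FP rF_mem_FP (comp_mem_FP fstF_mem_FP fstF_mem_FP)))
/-- `item2`: membership in `FP` by composition. [cite: AroraBarak2009, §1.3] -/
theorem item2_mem_FP (k : ℕ) : item2 k ∈ FP :=
  comp_mem_FP nthItemFn_mem_FP (fanoutFn_mem_FP sndF_mem_FP (comp_mem_FP sndF_mem_FP (comp_mem_FP (zF_mem_FP k)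
    (comp_mem_FP fstF_mem_FP fstF_mem_FP))))
/-- `xi2`: membership in `FP` by composition. [cite: AroraBarak2009, §1.3] -/
theorem xi2_mem_FP (k : ℕ) : xi2 k ∈ FP := comp_mem_FP appendFn_mem_FP (fanoutFn_mem_FP (triOf_mem_FP rmi2_mem_FP) (item2_mem_FP k))
/-- `bitP`: membership in `FP` by composition. [cite: AroraBarak2009, §1.3] -/
theorem bitP_mem_FP (k : ℕ) : bitP k ∈ FP :=
  iteFn_mem_FP (comp_mem_FP ltLenF_mem_FP (fanoutFn_mem_FP (comp_mem_FP sndF_mem_FP fstF_mem_FP) (xi2_mem_FP k)))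
    (const_mem_FP _) (const_mem_FP _)
/-- `initI`: membership in `FP` by composition. [cite: AroraBarak2009, §1.3] -/
theorem initI_mem_FP : initI ∈ FP :=
  fanoutFn_mem_FP (PolyTimeComputable.id _) (fanoutFn_mem_FP (comp_mem_FP lenBinF_mem_FP (comp_mem_FP fstF_mem_FP
    (comp_mem_FP (zF_mem_FP 1) fstF_mem_FP))) (const_mem_FP _))
/-- `countF k ∈ FP`. [cite: AroraBarak2009, §1.3] -/
theorem countF_mem_FP (k : ℕ) : countF k ∈ FP :=
  comp_mem_FP (sndPow_mem_FP 2) (comp_mem_FP (foldLoop_clipF_mem_FP 1 appF_mem_FP length_appF_le (bitP_mem_FP k) _) initI_mem_FP)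

/-- The genuine inner argument. [folklore] -/
def iargOf (a b c : List ℕ) (j i : ℕ) : List Bool := boolPair (pargOf a b c j) (ones i)

/-- Value of `sndF`. [folklore] -/
@[simp] theorem sndF_iargOf (a b c : List ℕ) (j i : ℕ) : sndF (iargOf a b c j i) = ones i := sndF_boolPair _ _
/-- Value of `fstF`. [folklore] -/
@[simp] theorem fstF_iargOf (a b c : List ℕ) (j i : ℕ) : fstF (iargOf a b c j i) = pargOf a b c j := fstF_boolPair _ _

/-- Value of `bitP`. [folklore] -/
theorem bitP_iargOf (k : ℕ) (a b c : List ℕ) (j i : ℕ) :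
    bitP k (iargOf a b c j i) = if j < liftK k a b c i then [true] else [] := by
  have hr : rmi2 (iargOf a b c j i) = ones (a.length - 1 - i) := by
    simp only [rmi2, Function.comp_apply, fanoutFn_apply, sndF_iargOf, fstF_iargOf, fstF_pargOf, rF_wordOf, dropFn_boolPair,
      List.length_replicate, List.drop_replicate]
  have hi : item2 k (iargOf a b c j i) = ones ((lst k a b c).getD i 0) := by
    simp only [item2, Function.comp_apply, fanoutFn_apply, sndF_iargOf, fstF_iargOf, fstF_pargOf, zF_wordOf, nthItemFn_code]
  have hx : xi2 k (iargOf a b c j i) = ones (liftK k a b c i) := by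
    rw [xi2, Function.comp_apply, fanoutFn_apply, triOf_val hr, hi, appendFn_boolPair, liftK, ones, ones, ← List.replicate_add]
  have h : (ltLenF ∘ fanoutFn (sndF ∘ fstF) (xi2 k)) (iargOf a b c j i) = [decide (j < liftK k a b c i)] := by
    rw [Function.comp_apply, fanoutFn_apply, hx, Function.comp_apply, fstF_iargOf, sndF_pargOf, ltLenF_boolPair,
      List.length_replicate, List.length_replicate]
  rw [bitP, iteFn_apply h]
  by_cases hj : j < liftK k a b c i <;> simp [hj]

/-- A concatenation of marks is the run of ones of their number. [folklore] -/
theorem ccat_marks (p : ℕ → Prop) [DecidablePred p] : ∀ K,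
    ccat (fun i => if p i then [true] else []) K = ones (((range K).filter p).card)
  | 0 => by simp
  | K + 1 => by
    rw [ccat_succ, ccat_marks p K, card_filter, card_filter, sum_range_succ]
    by_cases h : p K
    · rw [if_pos h, if_pos h, ones, ones, List.replicate_succ']
    · rw [if_neg h, if_neg h, List.append_nil, Nat.add_zero]

/-- The count `c_j = #{i < |μ'| : j < X_i}` of list `k`. [folklore] -/
def cnt (k : ℕ) (a b c : List ℕ) (j : ℕ) : ℕ := ((range a.length).filter fun i => j < liftK k a b c i).card

/-- A `ccat` depends only on the values of its pieces. [folklore] -/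
theorem ccat_congr {g g' : ℕ → List Bool} (h : ∀ j, g j = g' j) : ∀ K, ccat g K = ccat g' K
  | 0 => rfl
  | K + 1 => by rw [ccat_succ, ccat_succ, ccat_congr h K, h K]

/-- **Value of the count** on `⟨code, 1ʲ⟩`: `1^{c_j}`. [folklore] -/
theorem countF_pargOf (k : ℕ) (a b c : List ℕ) (j : ℕ) : countF k (pargOf a b c j) = ones (cnt k a b c j) := by
  have hinit : initI (pargOf a b c j) = boolPair (pargOf a b c j) (boolPair (encodeNat a.length) (boolPair (ones 0) [])) := by
    simp only [initI, fanoutFn_apply, id, Function.comp_apply, fstF_pargOf, z1F_wordOf, encodeUnaryList_eq, fstF_boolPair,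
      lenBinF_apply, List.length_replicate]
  have hk : a.length ≤ X.eval (pargOf a b c j).length := by
    rw [eval_X, pargOf, length_boolPair]; have := length_le_wordOf a b c; omega
  rw [countF, Function.comp_apply, Function.comp_apply, hinit, foldLoop_apply _ _ hk, foldAcc_clipF, foldAcc_appF,
    List.nil_append]
  · simp only [sndPow_succ_boolPair, sndPow_zero_boolPair, Nat.zero_add]
    rw [ccat_congr (g := fun i => bitP k (boolPair (pargOf a b c j) (ones i))) (g' := fun i => if j < liftK k a b c i then [true] else [])
      (fun i => bitP_iargOf k a b c j i), ccat_marks]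
    rfl
  · intro i _ _
    show (bitP k (iargOf a b c j i)).length ≤ _
    rw [bitP_iargOf]; split_ifs <;> simp

/-- The counts are at most `|μ'|`. [folklore] -/
theorem cnt_le (k : ℕ) (a b c : List ℕ) (j : ℕ) : cnt k a b c j ≤ a.length :=
  (card_filter_le _ _).trans_eq (card_range a.length)

/-- The counts are the entries of `rowCounts`. [folklore] -/
theorem map_cnt (k : ℕ) (a b c : List ℕ) : (List.range (liftK k a b c 0)).map (cnt k a b c) = rowCounts (liftK k a b c) a.length :=
  rfl

/-! ### The outer fold: the blocks `1^{c_j} 0` -/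

/-- On `⟨w, 1ʲ⟩`: the block `1^{c_j} 0`. [folklore] -/
def blockPiece (k : ℕ) : List Bool → List Bool := appendFn ∘ fanoutFn (countF k) (fun _ => [false])
/-- On a word: `1^{X_0}` for list `k` (`tri r +` item `0`). [folklore] -/
def x0F (k : ℕ) : List Bool → List Bool := appendFn ∘ fanoutFn (triOf rF) (nthItemFn ∘ fanoutFn (fun _ => []) (sndF ∘ zF k))
/-- The initial record of the outer fold: `⟨w, ⟨bin X_0, ⟨1⁰, ε⟩⟩⟩`. [folklore] -/
def initO (k : ℕ) : List Bool → List Bool := fanoutFn id (fanoutFn (lenBinF ∘ x0F k) (fun _ => boolPair (ones 0) []))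
/-- The bound on the number of blocks: `X_0 ≤ (|w| + 1)²`. [folklore] -/
def P2 : Polynomial ℕ := (X + 1) ^ 2
/-- **The blocks** `1^{c_0} 0 ⋯ 1^{c_{X_0 - 1}} 0` of list `k`. [folklore] -/
def blockF (k : ℕ) : List Bool → List Bool := sndPow 2 ∘ foldLoop appF (clipF 2 (blockPiece k)) P2 ∘ initO k
/-- **The unary code of the partition of list `k`**: the blocks and the terminating `0`. [folklore] -/
def codeK (k : ℕ) : List Bool → List Bool := appendFn ∘ fanoutFn (blockF k) (fun _ => [false])
/-- **The Kronecker code** `code λ ++ code μ ++ code π`. [cite: IkenmeyerMulmuleyWalter2017, §1.1 (KRONECKER, unary inputs)] -/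
def outputF : List Bool → List Bool := appendFn ∘ fanoutFn (codeK 1) (appendFn ∘ fanoutFn (codeK 2) (codeK 3))

/-- `blockPiece`: membership in `FP` by composition. [cite: AroraBarak2009, §1.3] -/
theorem blockPiece_mem_FP (k : ℕ) : blockPiece k ∈ FP :=
  comp_mem_FP appendFn_mem_FP (fanoutFn_mem_FP (countF_mem_FP k) (const_mem_FP _))
/-- `x0F`: membership in `FP` by composition. [cite: AroraBarak2009, §1.3] -/
theorem x0F_mem_FP (k : ℕ) : x0F k ∈ FP :=
  comp_mem_FP appendFn_mem_FP (fanoutFn_mem_FP (triOf_mem_FP rF_mem_FP) (comp_mem_FP nthItemFn_mem_FP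
    (fanoutFn_mem_FP (const_mem_FP _) (comp_mem_FP sndF_mem_FP (zF_mem_FP k)))))
/-- `initO`: membership in `FP` by composition. [cite: AroraBarak2009, §1.3] -/
theorem initO_mem_FP (k : ℕ) : initO k ∈ FP :=
  fanoutFn_mem_FP (PolyTimeComputable.id _) (fanoutFn_mem_FP (comp_mem_FP lenBinF_mem_FP (x0F_mem_FP k)) (const_mem_FP _))
/-- `blockF`: membership in `FP` by composition. [cite: AroraBarak2009, §1.3] -/
theorem blockF_mem_FP (k : ℕ) : blockF k ∈ FP :=
  comp_mem_FP (sndPow_mem_FP 2) (comp_mem_FP (foldLoop_clipF_mem_FP 2 appF_mem_FP length_appF_le (blockPiece_mem_FP k) _)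
    (initO_mem_FP k))
/-- `codeK`: membership in `FP` by composition. [cite: AroraBarak2009, §1.3] -/
theorem codeK_mem_FP (k : ℕ) : codeK k ∈ FP := comp_mem_FP appendFn_mem_FP (fanoutFn_mem_FP (blockF_mem_FP k) (const_mem_FP _))
/-- **`outputF ∈ FP`.** [cite: AroraBarak2009, §1.3] -/
theorem outputF_mem_FP : outputF ∈ FP :=
  comp_mem_FP appendFn_mem_FP (fanoutFn_mem_FP (codeK_mem_FP 1) (comp_mem_FP appendFn_mem_FP
    (fanoutFn_mem_FP (codeK_mem_FP 2) (codeK_mem_FP 3))))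

/-- Value of `x0F`. [folklore] -/
theorem x0F_wordOf (k : ℕ) (a b c : List ℕ) : x0F k (wordOf a b c) = ones (liftK k a b c 0) := by
  simp only [x0F, Function.comp_apply, fanoutFn_apply, triOf_val (rF_wordOf a b c), zF_wordOf,
    show ([] : List Bool) = ones 0 from rfl, nthItemFn_code, appendFn_boolPair, liftK, Nat.sub_zero, ones, ← List.replicate_add]

/-- Value of `blockPiece`. [folklore] -/
theorem blockPiece_pargOf (k : ℕ) (a b c : List ℕ) (j : ℕ) :
    blockPiece k (pargOf a b c j) = ones (cnt k a b c j) ++ [false] := by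
  rw [blockPiece, Function.comp_apply, fanoutFn_apply, countF_pargOf, appendFn_boolPair]

/-- `X_0 ≤ (|w| + 1)²` on a code. [folklore] -/
theorem liftK_zero_le (k : ℕ) (a b c : List ℕ) : liftK k a b c 0 ≤ ((wordOf a b c).length + 1) ^ 2 := by
  have h1 := getD_le_wordOf k a b c 0
  have hL := length_le_wordOf a b c
  rw [liftK, Nat.sub_zero]
  set L := (wordOf a b c).length
  have ht : tri (a.length - 1) ≤ L * (L + 1) := by
    unfold tri
    calc (a.length - 1) * (a.length - 1 + 1) / 2 ≤ (a.length - 1) * (a.length - 1 + 1) := Nat.div_le_self _ _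
      _ ≤ L * (L + 1) := Nat.mul_le_mul (by omega) (by omega)
  nlinarith

/-- The concatenated blocks are the flattened unary codes of the counts. [folklore] -/
theorem ccat_blocks (f : ℕ → ℕ) : ∀ K, ccat (fun j => ones (f j) ++ [false]) K = (((List.range K).map f).map unaryNat).flatten
  | 0 => by simp
  | K + 1 => by
    rw [ccat_succ, ccat_blocks f K, List.range_succ, List.map_append, List.map_append, List.flatten_append, List.map_singleton,
      List.map_singleton, List.flatten_singleton, unaryNat]

/-- **Value of the blocks of list `k`**: the blocks `1^{c_j} 0`, `j < X_0`, concatenated. [folklore] -/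
theorem blockF_wordOf (k : ℕ) (a b c : List ℕ) :
    blockF k (wordOf a b c) = ccat (fun j => ones (cnt k a b c j) ++ [false]) (liftK k a b c 0) := by
  obtain ⟨K, hK⟩ : ∃ K, liftK k a b c 0 = K := ⟨_, rfl⟩
  have hinit : initO k (wordOf a b c) = boolPair (wordOf a b c) (boolPair (encodeNat K) (boolPair (ones 0) [])) := by
    simp only [initO, fanoutFn_apply, id, Function.comp_apply, x0F_wordOf, hK, lenBinF_apply, List.length_replicate]
  have hk : K ≤ P2.eval (wordOf a b c).length := by
    rw [← hK, P2, eval_pow, eval_add, eval_X, eval_one]; exact liftK_zero_le k a b c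
  rw [hK, blockF, Function.comp_apply, Function.comp_apply, hinit, foldLoop_apply _ _ hk, foldAcc_clipF, foldAcc_appF,
    List.nil_append]
  · simp only [sndPow_succ_boolPair, sndPow_zero_boolPair, Nat.zero_add]
    exact ccat_congr (fun j => blockPiece_pargOf k a b c j) K
  · intro j _ _
    show (blockPiece k (pargOf a b c j)).length ≤ _
    rw [blockPiece_pargOf, List.length_append, List.length_replicate, List.length_singleton]
    have := cnt_le k a b c j
    have hL := length_le_wordOf a b c
    omega

/-- **Value of the partition code of list `k`**: `unaryList (rowCounts (liftK k) (r + 1))`. [folklore] -/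
theorem codeK_wordOf (k : ℕ) (a b c : List ℕ) : codeK k (wordOf a b c) = unaryList (rowCounts (liftK k a b c) a.length) := by
  rw [codeK, Function.comp_apply, fanoutFn_apply, appendFn_boolPair, blockF_wordOf, ccat_blocks, unaryList, map_cnt]

/-- **Value of the output on the code of an admissible instance**: the Kronecker code of the
simplex embedding. [cite: FischerIkenmeyer2020, Theorem 5] -/
theorem outputF_wordOf {a b c : List ℕ} (h : XRayAdmissible (a.length - 1) a b c) :
    outputF (wordOf a b c) = encodePartition (xrayLam (a.length - 1) a) ++ encodePartition (xrayMu (a.length - 1) a b) ++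
      encodePartition (xrayPi (a.length - 1) a c) := by
  have hn : a.length - 1 + 1 = a.length := by have := h.length₁; omega
  rw [outputF, Function.comp_apply, fanoutFn_apply, Function.comp_apply, fanoutFn_apply, codeK_wordOf, codeK_wordOf, codeK_wordOf,
    appendFn_boolPair, appendFn_boolPair, encodePartition_xrayLam h, encodePartition_xrayMu h, encodePartition_xrayPi h, hn,
    liftK_one, liftK_two, liftK_three, List.append_assoc]

/-! ### The reduction map and its identification with `xrayToKronecker` -/

/-- **The machine of the simplex embedding**: `(code test ∧ admissibility test) ? Kronecker code :
noCode`. [cite: FischerIkenmeyer2020, Theorem 5 and §6 (Fig. 2)] -/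
def xrayToKroneckerF : List Bool → List Bool := iteFn (andFn canonXF admissibleF) outputF (fun _ => noCode)

/-- **`xrayToKroneckerF ∈ FP`.** [cite: BrunettiDelLungoGerard2001, Thm. 3.1 (proof: "polynomial-time transformation")] -/
theorem xrayToKroneckerF_mem_FP : xrayToKroneckerF ∈ FP :=
  iteFn_mem_FP (andFn_mem_FP canonXF_mem_FP admissibleF_mem_FP) outputF_mem_FP (const_mem_FP _)

/-- **The machine computes `xrayToKronecker`** on every string. [cite: FischerIkenmeyer2020, Theorem 5] -/
theorem xrayToKroneckerF_eq : xrayToKroneckerF = xrayToKronecker := by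
  funext w
  by_cases hw : ∃ I : List ℕ × List ℕ × List ℕ, encodingTwoDXRay.encode I = w
  · obtain ⟨⟨a, b, c⟩, rfl⟩ := hw
    have hc : canonXF (wordOf a b c) = [true] := (canonXF_eq_true_iff _).2 ⟨_, rfl⟩
    obtain ⟨bb, hb⟩ := oneBit_admissibleF (wordOf a b c)
    rw [show encodingTwoDXRay.encode (a, b, c) = wordOf a b c from rfl, xrayToKroneckerF, iteFn_apply (andFn_apply hc hb),
      Bool.true_and, show wordOf a b c = encodingTwoDXRay.encode (a, b, c) from rfl, xrayToKronecker_encode]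
    by_cases hadm : XRayAdmissible (a.length - 1) a b c
    · have : bb = true := by
        have := (admissibleF_wordOf_eq_true_iff a b c).2 hadm; rw [hb] at this; simpa using this
      subst this
      rw [if_pos rfl, if_pos hadm]; exact outputF_wordOf hadm
    · have : bb = false := by
        cases bb
        · rfl
        · exact absurd ((admissibleF_wordOf_eq_true_iff a b c).1 hb) hadm
      subst this
      rw [if_neg Bool.false_ne_true, if_neg hadm]
  · have hc : canonXF w = [false] := by
      obtain ⟨bb, hb⟩ := oneBit_canonXF w
      cases bb
      · exact hb
      · exact absurd ((canonXF_eq_true_iff w).1 hb) hw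
    obtain ⟨bb, hb⟩ := oneBit_admissibleF w
    rw [xrayToKroneckerF, iteFn_apply (andFn_apply hc hb), Bool.false_and, if_neg Bool.false_ne_true,
      xrayToKronecker_of_not_exists hw]

end XRayKron

/-! ### Discharges -/

/-- **Discharge of `FischerIkenmeyer2020_xrayToKronecker_mem_FP`**: the simplex embedding
`2D-X-RAY → KRONECKER` is polynomial time. [cite: FischerIkenmeyer2020, Theorem 5 and §6 (Fig. 2)] [cite: BrunettiDelLungoGerard2001, Thm. 3.1 (proof)] -/
theorem FischerIkenmeyer2020_xrayToKronecker_mem_FP_holds : FischerIkenmeyer2020_xrayToKronecker_mem_FP := by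
  rw [FischerIkenmeyer2020_xrayToKronecker_mem_FP, ← XRayKron.xrayToKroneckerF_eq]
  exact XRayKron.xrayToKroneckerF_mem_FP

/-- **Discharge of `IMW2017_kroneckerNPHard` — Ikenmeyer–Mulmuley–Walter 2017, Thm. 1.1: deciding
positivity of Kronecker coefficients (partitions in unary) is NP-hard.** Both leaves of
`IMW2017_kroneckerNPHard_of_GGP` are now theorems: `GGP1999_twoDXRayNPHard_holds`
(`TwoDXRayCircuitBoard.lean`) and `FischerIkenmeyer2020_xrayToKronecker_mem_FP_holds`.
[cite: IkenmeyerMulmuleyWalter2017, Thm. 1.1 and Thm. 3.4] -/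
theorem IMW2017_kroneckerNPHard_holds : IMW2017_kroneckerNPHard :=
  IMW2017_kroneckerNPHard_of_GGP Literature.Computability.Complexity.GGP1999_twoDXRayNPHard_holds
    FischerIkenmeyer2020_xrayToKronecker_mem_FP_holds

/-- The barrier conjunction `KroneckerPlethysmHardness` now rests on its plethysm half alone.
[cite: IkenmeyerMulmuleyWalter2017, Thm. 1.1] -/
theorem kroneckerPlethysmHardness_of_plethysm (hFI : FischerIkenmeyer2020_plethysmNPHard) : KroneckerPlethysmHardness :=
  ⟨IMW2017_kroneckerNPHard_holds, hFI⟩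

end Literature.Barriers.ValiantsHypothesis
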